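import Summits.AtomisticToContinuum.HydrodynamicLimit.Theorems.EnskogAdjointDualityAdjointEnskogTestFamilyRSpatialTransfer
import Summits.AtomisticToContinuum.HydrodynamicLimit.Theorems.EnskogAdjointDualityAdjointEnskogTestFamilyRSphereCalculus
import Literature.Analysis.FunctionSpaces.PeriodicLogCost
import HarnessLib

/-!
# K2R refutation, identity (I), `ψ`-part — torus and sphere averages (stub `psiOne`, file 2 of 3)

Route `EnskogAdjointDuality` of `AtomisticToContinuum/HydrodynamicLimit`, crux K2R `AdjointEnskogTestFamilyR`
(stmt-AtomisticToContinuum-11592), line `refutation`, registered stub `stub_psiOne`.  Position-side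
ingredients of the assembly (file `…RPsiOne`): continuity of parametric sphere integrals, the Haar shift of
the sine profile `∫ sin(2πx₀) γ(x + εω) dx = cos(2πεω₀) Γ_s − sin(2πεω₀) Γ_c` (keyed sub-goal
`stub_psiOne_prep`), the delocalised average `∫ sin(2πx₀) ∫_{S²} ω₀ (γ(x+εω) − γ(x)) dσ dx = −s_ε Γ_c`
(`∫ ν₀ (cos(kν₀) − 1) dσ = 0`, from `stub_sphereCalculus`), and the angular averages
`Φ_β(x) = ∫ ω₀⟪β(x⁺)−β(x),ω⟫ dσ`, `Φ_γ(x) = ∫ ω₀ (γ(x⁺)−γ(x)) dσ` (continuity, `|Φ_β| ≤ 8πC`).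

References: C. Cercignani, R. Illner, M. Pulvirenti, *The Mathematical Theory of Dilute Gases* (1994),
§3.1 [CIP1994]; folklore calculus on the flat torus.
-/

noncomputable section

open MeasureTheory Set Filter Function Metric
open scoped InnerProductSpace Real

namespace Summit.AtomisticToContinuum.HydrodynamicLimit.Theorems.EnskogAdjointDuality

open Literature.MathematicalPhysics.KineticTheory Literature.Analysis.FluidPDE Literature.Analysis.FunctionSpaces

/-! ## Torus and sphere averages -/

/-- Continuous functions on `𝕋³ × S²` are integrable for `vol ⊗ σ`. [folklore] -/
theorem k2r_ref_p1_integrable_torus_sphere {f : T3 × sphere (0 : V3) 1 → ℝ} (hf : Continuous f) :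
    Integrable f ((volume : Measure T3).prod (sphereMeasure : Measure (sphere (0 : V3) 1))) := by
  haveI := isFiniteMeasure_sphereMeasure (E := V3)
  exact hf.integrable_of_hasCompactSupport (HasCompactSupport.of_compactSpace f)

/-- Parametric sphere integrals of jointly continuous integrands are continuous. [folklore] -/
theorem k2r_ref_p1_continuous_sphere_integral {X : Type*} [TopologicalSpace X]
    [FirstCountableTopology X] [LocallyCompactSpace X] {f : X → sphere (0 : V3) 1 → ℝ}
    (hf : Continuous (Function.uncurry f)) :
    Continuous fun x => ∫ ω, f x ω ∂(sphereMeasure : Measure (sphere (0 : V3) 1)) := by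
  haveI := isFiniteMeasure_sphereMeasure (E := V3)
  have h := continuous_parametric_integral_of_continuous
    (μ := (sphereMeasure : Measure (sphere (0 : V3) 1))) hf isCompact_univ
  simpa only [Measure.restrict_univ] using h

/-- **Haar shift of the sine profile**: for continuous `γ` on `𝕋³`,
`∫ sin(2πx₀) γ(x + εω) dx = cos(2πεω₀) ∫ sin(2πx₀) γ − sin(2πεω₀) ∫ cos(2πx₀) γ`
(translation invariance of Haar measure and `sin(a − b)`). [folklore] -/
theorem k2r_ref_p1_integral_sin_mul_translate {γ : T3 → ℝ} (hγ : Continuous γ) (ε : ℝ) (ω : V3) :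
    ∫ x : T3, Torus.sinCoord 0 x * γ (x + Torus.proj (ε • ω)) =
      Real.cos (2 * Real.pi * ε * ω 0) * (∫ x : T3, Torus.sinCoord 0 x * γ x) -
        Real.sin (2 * Real.pi * ε * ω 0) * (∫ x : T3, Torus.cosCoord 0 x * γ x) := by
  set p : T3 := Torus.proj (ε • ω) with hp
  have hs : Continuous (Torus.sinCoord (0 : Fin 3) : T3 → ℝ) := (Torus.isSmooth_sinCoord 0).continuous
  have hc : Continuous (Torus.cosCoord (0 : Fin 3) : T3 → ℝ) := (Torus.isSmooth_cosCoord 0).continuous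
  have h1 : ∫ x : T3, Torus.sinCoord 0 x * γ (x + p) = ∫ x : T3, Torus.sinCoord 0 (x - p) * γ x := by
    have h := integral_sub_right_eq_self (μ := (volume : Measure T3))
      (fun x => Torus.sinCoord 0 x * γ (x + p)) p
    simp only [sub_add_cancel] at h
    exact h.symm
  have h2 : ∀ x : T3, Torus.sinCoord 0 (x - p) =
      Real.cos (2 * Real.pi * ε * ω 0) * Torus.sinCoord 0 x -
        Real.sin (2 * Real.pi * ε * ω 0) * Torus.cosCoord 0 x := by
    intro x
    obtain ⟨r, hr⟩ := Torus.exists_coe_eq (x 0)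
    have hx : (x - p) 0 = ((r - ε * ω 0 : ℝ) : UnitAddCircle) := by
      rw [Pi.sub_apply, hp, Torus.proj_apply, ← hr]
      push_cast
      simp
    rw [Torus.sinCoord_of_eq hx, Torus.sinCoord_of_eq hr.symm, Torus.cosCoord_of_eq hr.symm, mul_sub,
      Real.sin_sub]
    ring_nf
  rw [h1]
  simp_rw [h2]
  have i1 : Integrable (fun x : T3 => Torus.sinCoord 0 x * γ x) := (hs.mul hγ).integrable_unitAddTorus
  have i2 : Integrable (fun x : T3 => Torus.cosCoord 0 x * γ x) := (hc.mul hγ).integrable_unitAddTorus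
  have e : ∀ x : T3, (Real.cos (2 * Real.pi * ε * ω 0) * Torus.sinCoord 0 x -
      Real.sin (2 * Real.pi * ε * ω 0) * Torus.cosCoord 0 x) * γ x =
      Real.cos (2 * Real.pi * ε * ω 0) * (Torus.sinCoord 0 x * γ x) -
        Real.sin (2 * Real.pi * ε * ω 0) * (Torus.cosCoord 0 x * γ x) := fun x => by ring
  simp_rw [e]
  rw [integral_sub (i1.const_mul _) (i2.const_mul _), integral_const_mul, integral_const_mul]

/-- **Delocalised sine average**: for continuous `γ` on `𝕋³` and `0 ≤ k = 2πε ≤ π/2`,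
`∫ sin(2πx₀) ∫_{S²} ω₀ (γ(x + εω) − γ(x)) dσ dx = −s_k ∫ cos(2πx₀) γ`, `s_k = ∫ ν₀ sin(kν₀) dσ`
(Fubini, the Haar shift, and `∫ ν₀ (cos(kν₀) − 1) dσ = 0` from `stub_sphereCalculus`). [folklore] -/
theorem k2r_ref_p1_delocalised_sin {γ : T3 → ℝ} (hγ : Continuous γ) {ε : ℝ} (hε : 0 ≤ 2 * Real.pi * ε)
    (hk : 2 * Real.pi * ε ≤ Real.pi / 2) :
    ∫ x : T3, Torus.sinCoord 0 x * ∫ ω : sphere (0 : V3) 1,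
        (ω : V3) 0 * (γ (x + Torus.proj (ε • (ω : V3))) - γ x) ∂sphereMeasure =
      -(∫ ν : sphere (0 : V3) 1, (ν : V3) 0 * Real.sin (2 * Real.pi * ε * (ν : V3) 0) ∂sphereMeasure) *
        ∫ x : T3, Torus.cosCoord 0 x * γ x := by
  obtain ⟨-, htrig, -⟩ := stub_sphereCalculus
  obtain ⟨-, hcos0, -⟩ := htrig (2 * Real.pi * ε) hε hk
  have hs : Continuous (Torus.sinCoord (0 : Fin 3) : T3 → ℝ) := (Torus.isSmooth_sinCoord 0).continuous
  have hpr := Torus.continuous_proj (d := Fin 3)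
  have hco : Continuous fun ω : sphere (0 : V3) 1 => (ω : V3) 0 := by fun_prop
  set Γs : ℝ := ∫ x : T3, Torus.sinCoord 0 x * γ x with hΓs
  set Γc : ℝ := ∫ x : T3, Torus.cosCoord 0 x * γ x with hΓc
  have hF : Continuous fun q : T3 × sphere (0 : V3) 1 =>
      Torus.sinCoord 0 q.1 * ((q.2 : V3) 0 * (γ (q.1 + Torus.proj (ε • (q.2 : V3))) - γ q.1)) := by
    fun_prop
  have hint := k2r_ref_p1_integrable_torus_sphere hF
  have hinner : ∀ ω : sphere (0 : V3) 1,
      ∫ x : T3, Torus.sinCoord 0 x * ((ω : V3) 0 * (γ (x + Torus.proj (ε • (ω : V3))) - γ x)) =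
        (ω : V3) 0 * ((Real.cos (2 * Real.pi * ε * (ω : V3) 0) - 1) * Γs -
          Real.sin (2 * Real.pi * ε * (ω : V3) 0) * Γc) := fun ω => by
    have i1 : Integrable (fun x : T3 => Torus.sinCoord 0 x * γ x) := (hs.mul hγ).integrable_unitAddTorus
    have i2 : Integrable (fun x : T3 => Torus.sinCoord 0 x * γ (x + Torus.proj (ε • (ω : V3)))) :=
      (hs.mul (hγ.comp (continuous_id.add continuous_const))).integrable_unitAddTorus
    have e : ∀ x : T3, Torus.sinCoord 0 x * ((ω : V3) 0 * (γ (x + Torus.proj (ε • (ω : V3))) - γ x)) =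
        (ω : V3) 0 * (Torus.sinCoord 0 x * γ (x + Torus.proj (ε • (ω : V3))) -
          Torus.sinCoord 0 x * γ x) := fun x => by ring
    simp_rw [e]
    rw [integral_const_mul, integral_sub i2 i1, k2r_ref_p1_integral_sin_mul_translate hγ ε (ω : V3)]
    ring
  have hI1 : Integrable (fun ω : sphere (0 : V3) 1 =>
      (ω : V3) 0 * (Real.cos (2 * Real.pi * ε * (ω : V3) 0) - 1)) sphereMeasure :=
    ClampedCorrectorBirth.integrable_sphere_of_continuous' (by fun_prop)
  have hI2 : Integrable (fun ω : sphere (0 : V3) 1 =>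
      (ω : V3) 0 * Real.sin (2 * Real.pi * ε * (ω : V3) 0)) sphereMeasure :=
    ClampedCorrectorBirth.integrable_sphere_of_continuous' (by fun_prop)
  calc (∫ x : T3, Torus.sinCoord 0 x * ∫ ω : sphere (0 : V3) 1,
          (ω : V3) 0 * (γ (x + Torus.proj (ε • (ω : V3))) - γ x) ∂sphereMeasure)
      = ∫ x : T3, ∫ ω : sphere (0 : V3) 1,
          Torus.sinCoord 0 x * ((ω : V3) 0 * (γ (x + Torus.proj (ε • (ω : V3))) - γ x)) ∂sphereMeasure :=
        integral_congr_ae (Eventually.of_forall fun x => (integral_const_mul _ _).symm)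
    _ = ∫ ω : sphere (0 : V3) 1, (∫ x : T3,
          Torus.sinCoord 0 x * ((ω : V3) 0 * (γ (x + Torus.proj (ε • (ω : V3))) - γ x))) ∂sphereMeasure :=
        integral_integral_swap hint
    _ = ∫ ω : sphere (0 : V3) 1, (Γs * ((ω : V3) 0 * (Real.cos (2 * Real.pi * ε * (ω : V3) 0) - 1)) -
          Γc * ((ω : V3) 0 * Real.sin (2 * Real.pi * ε * (ω : V3) 0))) ∂sphereMeasure := by
        refine integral_congr_ae (Eventually.of_forall fun ω => ?_)
        dsimp only
        rw [hinner ω]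
        ring
    _ = Γs * (∫ ω : sphere (0 : V3) 1, (ω : V3) 0 * (Real.cos (2 * Real.pi * ε * (ω : V3) 0) - 1) ∂sphereMeasure) -
          Γc * ∫ ω : sphere (0 : V3) 1, (ω : V3) 0 * Real.sin (2 * Real.pi * ε * (ω : V3) 0) ∂sphereMeasure := by
        rw [integral_sub (hI1.const_mul _) (hI2.const_mul _), integral_const_mul, integral_const_mul]
    _ = _ := by rw [hcos0]; ring

/-! ## The angular averages `Φ_β`, `Φ_γ` -/

/-- **The angular averages** `Φ_β(x) = ∫ ω₀⟪β(x⁺)−β(x),ω⟫ dσ`, `Φ_γ(x) = ∫ ω₀ (γ(x⁺)−γ(x)) dσ` (pinned by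
their defining equations) are continuous on `𝕋³`, and `|Φ_β| ≤ 8πC` for `‖cc‖ ≤ C`. [folklore] -/
theorem k2r_ref_p1_Phi_facts {C : ℝ} {cc : T3 → ℝ × V3 × ℝ} (hcc : Continuous cc) (hbd : ∀ x, ‖cc x‖ ≤ C)
    (ε : ℝ) {ΦB ΦG : T3 → ℝ}
    (hΦB : ∀ x, ΦB x = ∫ ω : sphere (0 : V3) 1, (ω : V3) 0 *
      ⟪(cc (x + Torus.proj (ε • (ω : V3)))).2.1 - (cc x).2.1, (ω : V3)⟫_ℝ ∂sphereMeasure)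
    (hΦG : ∀ x, ΦG x = ∫ ω : sphere (0 : V3) 1, (ω : V3) 0 *
      ((cc (x + Torus.proj (ε • (ω : V3)))).2.2 - (cc x).2.2) ∂sphereMeasure) :
    Continuous ΦB ∧ Continuous ΦG ∧ ∀ x, |ΦB x| ≤ 8 * Real.pi * C := by
  haveI := isFiniteMeasure_sphereMeasure (E := V3)
  have hp := Torus.continuous_proj (d := Fin 3)
  have hβ : ∀ y, ‖(cc y).2.1‖ ≤ C := fun y => ((norm_fst_le _).trans (norm_snd_le _)).trans (hbd y)
  have hv0 : ∀ v : V3, |v 0| ≤ ‖v‖ := fun v => by simpa using PiLp.norm_apply_le v 0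
  refine ⟨?_, ?_, fun x => ?_⟩
  · rw [(funext hΦB : ΦB = _)]
    refine k2r_ref_p1_continuous_sphere_integral ?_
    show Continuous fun q : T3 × sphere (0 : V3) 1 => (q.2 : V3) 0 *
      ⟪(cc (q.1 + Torus.proj (ε • (q.2 : V3)))).2.1 - (cc q.1).2.1, (q.2 : V3)⟫_ℝ
    fun_prop
  · rw [(funext hΦG : ΦG = _)]
    refine k2r_ref_p1_continuous_sphere_integral ?_
    show Continuous fun q : T3 × sphere (0 : V3) 1 => (q.2 : V3) 0 *
      ((cc (q.1 + Torus.proj (ε • (q.2 : V3)))).2.2 - (cc q.1).2.2)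
    fun_prop
  · have hb : ∀ ω : sphere (0 : V3) 1, ‖(ω : V3) 0 *
        ⟪(cc (x + Torus.proj (ε • (ω : V3)))).2.1 - (cc x).2.1, (ω : V3)⟫_ℝ‖ ≤ 2 * C := fun ω => by
      have hω : ‖(ω : V3)‖ = 1 := norm_eq_of_mem_sphere ω
      have h0 : |(ω : V3) 0| ≤ 1 := (hv0 (ω : V3)).trans hω.le
      have hi : |⟪(cc (x + Torus.proj (ε • (ω : V3)))).2.1 - (cc x).2.1, (ω : V3)⟫_ℝ| ≤ 2 * C := by
        refine (abs_real_inner_le_norm _ _).trans ?_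
        rw [hω, mul_one]
        exact (norm_sub_le _ _).trans (by linarith [hβ (x + Torus.proj (ε • (ω : V3))), hβ x])
      rw [Real.norm_eq_abs, abs_mul]
      calc |(ω : V3) 0| * |⟪(cc (x + Torus.proj (ε • (ω : V3)))).2.1 - (cc x).2.1, (ω : V3)⟫_ℝ|
          ≤ 1 * (2 * C) := mul_le_mul h0 hi (abs_nonneg _) zero_le_one
        _ = 2 * C := one_mul _
    have h := norm_integral_le_of_norm_le_const (μ := (sphereMeasure : Measure (sphere (0 : V3) 1)))
      (Eventually.of_forall hb)
    rw [k2r_sphereMeasure_real_univ, Real.norm_eq_abs] at h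
    rw [hΦB x]
    linarith

/-- **Registered sub-goal `stub_psiOne_prep`** (keyed theorem of this preparatory file): the Haar shift
of the sine profile against a continuous coefficient, `k2r_ref_p1_integral_sin_mul_translate`. [folklore] -/
theorem stub_psiOne_prep : ∀ (γ : UnitAddTorus (Fin 3) → ℝ), Continuous γ → ∀ (ε : ℝ) (ω : EuclideanSpace ℝ (Fin 3)), (∫ x : UnitAddTorus (Fin 3), Literature.Analysis.FunctionSpaces.Torus.sinCoord 0 x * γ (x + Literature.Analysis.FunctionSpaces.Torus.proj (ε • ω))) = Real.cos (2 * Real.pi * ε * ω 0) * (∫ x : UnitAddTorus (Fin 3), Literature.Analysis.FunctionSpaces.Torus.sinCoord 0 x * γ x) - Real.sin (2 * Real.pi * ε * ω 0) * (∫ x : UnitAddTorus (Fin 3), Literature.Analysis.FunctionSpaces.Torus.cosCoord 0 x * γ x) :=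
  fun _ hγ ε ω => k2r_ref_p1_integral_sin_mul_translate hγ ε ω

end Summit.AtomisticToContinuum.HydrodynamicLimit.Theorems.EnskogAdjointDuality
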